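import Mathlib.Analysis.Calculus.LineDeriv.IntegrationByParts
import Mathlib.MeasureTheory.Measure.Haar.NormedSpace
import Literature.Analysis.UnboundedOperators.FourierSpectrum
import Literature.Analysis.UnboundedOperators.UnitaryGroupSmearing
import HarnessLib

/-!
# Smeared operators `∫ k(a) U(a) da` of a unitary representation of a translation group

Topic `Literature/Analysis/UnboundedOperators`, proofs layer over items C4/C5 (`UnitaryRep`,
`FourierSpectrum`). For a strongly continuous unitary representation `U` of the translation group
of a finite-dimensional real inner product space `P` (space-time) on a complex Hilbert space and an
integrable kernel `k : P → ℂ` we study the *smeared* (Bochner-integrated) vectors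

  `U[k] ψ := ∫ k(a) • U(a) ψ da`,   `U(a) = U (Multiplicative.ofAdd a)`,

the operators `∫ ρ(a) U(a, 1) da` through which Streater–Wightman formulate the spectral condition
(*PCT, Spin and Statistics, and All That*, §2-6, (2-113)–(2-114), and §3-1). This is the
several-variable companion of `UnitaryGroupSmearing` (the one-parameter case); everything is
elementary Bochner-integral calculus, no spectral theorem is used:

* `integrable_smul_apply`, `norm_integral_smul_apply_le`, `inner_integral_smul_apply`: `U[k]ψ`
  exists, `‖U[k]ψ‖ ≤ ‖k‖₁ ‖ψ‖`, `⟪φ, U[k]ψ⟫ = ∫ k(a) ⟪φ, U(a)ψ⟫ da`;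
* `inner_integral_smul_apply_left`: `U[k]* = U[k†]`, `k†(a) = conj k(-a)`;
* `apply_integral_smul_apply`, `apply_integral_smul_apply'`: `U(t) U[k] = U[k(· - t)] = U[k] U(t)`;
* `integral_smul_apply_integral_smul_apply`: `U[k₁] U[k₂] = U[k₁ ⋆ k₂]` (Fubini);
* `tendsto_integral_dilate_smul_apply`: `U[Rᴰ k(R ·)] x → (∫ k) • x` as `R → ∞`
  (approximate identities, `D = dim P`);
* `integral_smul_apply_mem_generator_domain`, `integral_smul_apply_generator_eq_neg`: for the
  one-parameter group `t ↦ U(t e)` of translations along `e` with generator `A_e`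
  (`UnitaryRep.alongDirection`), `U[k] D(A_e) ⊆ D(A_e)`, `A_e U[k] x = U[k] A_e x = -U[∂_e k] x`
  for Schwartz `k` (integration by parts along `e`, Mathlib's
  `integral_bilinear_hasLineDerivAt_right_eq_neg_left_of_integrable`).

## References

* R. F. Streater, A. S. Wightman, *PCT, Spin and Statistics, and All That* (1964), §2-6
  eqs. (2-113)–(2-114), §3-1. [StreaterWightman1964]
* M. Reed, B. Simon, *Methods of Modern Mathematical Physics I*, §VIII.4, Thm. VIII.7.
  [ReedSimonI1980]

## Design notes

* No definitions: the smeared vector is always written `∫ a, k a • U (Multiplicative.ofAdd a) ψ`;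
  a bundled bounded operator is provided existentially (`exists_clm_integral_smul_apply`).
* Kernels are `k : P → ℂ` with `Integrable k`; the integration-by-parts lemma takes a Schwartz
  kernel `k : 𝓢(P, ℂ)` and Mathlib's line derivative `∂_{e} k` (`LineDeriv` notation).
-/

noncomputable section

open MeasureTheory Filter Complex
open scoped InnerProductSpace Topology ComplexConjugate SchwartzMap LineDeriv

namespace Literature.Analysis.UnboundedOperators

namespace UnitaryRep

variable {P : Type*} [NormedAddCommGroup P] [InnerProductSpace ℝ P] [FiniteDimensional ℝ P]
  [MeasurableSpace P] [BorelSpace P]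
variable {H : Type*} [NormedAddCommGroup H] [InnerProductSpace ℂ H] [CompleteSpace H]

/-! ### Existence, bound, matrix coefficients -/

/-- For integrable `k`, the smeared orbit `a ↦ k(a) • U(a)ψ` is Bochner integrable (its norm is
`‖k(a)‖ ‖ψ‖`; Streater–Wightman §2-6, the operators `∫ ρ(a) U(a,1) da`). [folklore] -/
theorem integrable_smul_apply (U : UnitaryRep (Multiplicative P) H) {k : P → ℂ} (hk : Integrable k)
    (ψ : H) : Integrable fun a => k a • U (Multiplicative.ofAdd a) ψ := by
  refine (hk.norm.mul_const ‖ψ‖).mono'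
    (hk.aestronglyMeasurable.smul
      ((U.continuous_apply_apply ψ).comp continuous_ofAdd).aestronglyMeasurable)
    (Eventually.of_forall fun a => ?_)
  rw [norm_smul, norm_map]

/-- `‖∫ k(a) • U(a)ψ da‖ ≤ ‖k‖₁ ‖ψ‖`. [folklore] -/
theorem norm_integral_smul_apply_le (U : UnitaryRep (Multiplicative P) H) (k : P → ℂ) (ψ : H) :
    ‖∫ a, k a • U (Multiplicative.ofAdd a) ψ‖ ≤ (∫ a, ‖k a‖) * ‖ψ‖ := by
  calc ‖∫ a, k a • U (Multiplicative.ofAdd a) ψ‖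
      ≤ ∫ a, ‖k a • U (Multiplicative.ofAdd a) ψ‖ := norm_integral_le_integral_norm _
    _ = ∫ a, ‖k a‖ * ‖ψ‖ := by simp_rw [norm_smul, norm_map]
    _ = (∫ a, ‖k a‖) * ‖ψ‖ := integral_mul_const _ _

/-- **Matrix coefficients of a smeared vector**: `⟪φ, ∫ k(a) • U(a)ψ da⟫ = ∫ k(a) ⟪φ, U(a)ψ⟫ da`
(Streater–Wightman §2-6, passage from `∫ ρ(a) U(a,1) da = 0` to `∫ ρ(a) (Φ, U(a,1)Ψ) da = 0`).
[cite: StreaterWightman1964, §2-6 eqs. (2-113)–(2-114)] -/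
theorem inner_integral_smul_apply (U : UnitaryRep (Multiplicative P) H) {k : P → ℂ}
    (hk : Integrable k) (φ ψ : H) :
    ⟪φ, ∫ a, k a • U (Multiplicative.ofAdd a) ψ⟫_ℂ =
      ∫ a, k a * ⟪φ, U (Multiplicative.ofAdd a) ψ⟫_ℂ := by
  rw [← integral_inner (U.integrable_smul_apply hk ψ)]
  simp_rw [inner_smul_right]

/-- Additivity of smearing in the vector. [folklore] -/
theorem integral_smul_apply_add (U : UnitaryRep (Multiplicative P) H) {k : P → ℂ}
    (hk : Integrable k) (ψ₁ ψ₂ : H) :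
    ∫ a, k a • U (Multiplicative.ofAdd a) (ψ₁ + ψ₂) =
      (∫ a, k a • U (Multiplicative.ofAdd a) ψ₁) + ∫ a, k a • U (Multiplicative.ofAdd a) ψ₂ := by
  rw [← integral_add (U.integrable_smul_apply hk ψ₁) (U.integrable_smul_apply hk ψ₂)]
  simp_rw [map_add, smul_add]

/-- Homogeneity of smearing in the vector. [folklore] -/
theorem integral_smul_apply_smul (U : UnitaryRep (Multiplicative P) H) (k : P → ℂ) (c : ℂ)
    (ψ : H) :
    ∫ a, k a • U (Multiplicative.ofAdd a) (c • ψ) = c • ∫ a, k a • U (Multiplicative.ofAdd a) ψ := by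
  rw [← integral_smul]
  simp_rw [map_smul, smul_comm (k _) c]

/-- Additivity of smearing in the kernel. [folklore] -/
theorem integral_add_smul_apply (U : UnitaryRep (Multiplicative P) H) {k₁ k₂ : P → ℂ}
    (hk₁ : Integrable k₁) (hk₂ : Integrable k₂) (ψ : H) :
    ∫ a, (k₁ a + k₂ a) • U (Multiplicative.ofAdd a) ψ =
      (∫ a, k₁ a • U (Multiplicative.ofAdd a) ψ) + ∫ a, k₂ a • U (Multiplicative.ofAdd a) ψ := by
  rw [← integral_add (U.integrable_smul_apply hk₁ ψ) (U.integrable_smul_apply hk₂ ψ)]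
  simp_rw [add_smul]

/-- Smearing is subtractive in the kernel. [folklore] -/
theorem integral_sub_smul_apply (U : UnitaryRep (Multiplicative P) H) {k₁ k₂ : P → ℂ}
    (hk₁ : Integrable k₁) (hk₂ : Integrable k₂) (ψ : H) :
    ∫ a, (k₁ a - k₂ a) • U (Multiplicative.ofAdd a) ψ =
      (∫ a, k₁ a • U (Multiplicative.ofAdd a) ψ) - ∫ a, k₂ a • U (Multiplicative.ofAdd a) ψ := by
  rw [← integral_sub (U.integrable_smul_apply hk₁ ψ) (U.integrable_smul_apply hk₂ ψ)]
  simp_rw [sub_smul]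

/-- Homogeneity of smearing in the kernel. [folklore] -/
theorem integral_const_mul_smul_apply (U : UnitaryRep (Multiplicative P) H) (k : P → ℂ) (c : ℂ)
    (ψ : H) :
    ∫ a, (c * k a) • U (Multiplicative.ofAdd a) ψ = c • ∫ a, k a • U (Multiplicative.ofAdd a) ψ := by
  rw [← integral_smul]
  simp_rw [mul_smul]

/-- **The smeared operator is bounded**: `ψ ↦ ∫ k(a) • U(a)ψ da` is a continuous linear map of
norm `≤ ‖k‖₁` (stated existentially; no new definition). [folklore] -/
theorem exists_clm_integral_smul_apply (U : UnitaryRep (Multiplicative P) H) {k : P → ℂ}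
    (hk : Integrable k) :
    ∃ S : H →L[ℂ] H, ∀ ψ, S ψ = ∫ a, k a • U (Multiplicative.ofAdd a) ψ := by
  refine ⟨LinearMap.mkContinuous
    { toFun := fun ψ => ∫ a, k a • U (Multiplicative.ofAdd a) ψ
      map_add' := U.integral_smul_apply_add hk
      map_smul' := fun c ψ => U.integral_smul_apply_smul k c ψ } (∫ a, ‖k a‖)
    (fun ψ => U.norm_integral_smul_apply_le k ψ), fun ψ => rfl⟩

/-- Continuity of smearing in the vector. [folklore] -/
theorem continuous_integral_smul_apply (U : UnitaryRep (Multiplicative P) H) {k : P → ℂ}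
    (hk : Integrable k) : Continuous fun ψ : H => ∫ a, k a • U (Multiplicative.ofAdd a) ψ := by
  obtain ⟨S, hS⟩ := U.exists_clm_integral_smul_apply hk
  simp_rw [← hS]
  exact S.continuous

/-! ### Adjoint and translation -/

omit [InnerProductSpace ℝ P] [FiniteDimensional ℝ P] [MeasurableSpace P] [BorelSpace P] in
/-- `⟪U(a) x, y⟫ = ⟪x, U(-a) y⟫`: the adjoint of `U(a)` is `U(-a)` (Folland (1995), §3.1). [folklore] -/
theorem inner_apply_ofAdd_left (U : UnitaryRep (Multiplicative P) H) (a : P) (x y : H) :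
    ⟪U (Multiplicative.ofAdd a) x, y⟫_ℂ = ⟪x, U (Multiplicative.ofAdd (-a)) y⟫_ℂ := by
  rw [← ContinuousLinearMap.adjoint_inner_right, U.adjoint_apply, ofAdd_neg]

/-- The reflected conjugate kernel `k†(a) = conj k(-a)` is integrable. [folklore] -/
theorem integrable_conj_comp_neg_vec {k : P → ℂ} (hk : Integrable k) :
    Integrable fun a : P => conj (k (-a)) := by
  refine (hk.comp_neg.norm).mono'
    (continuous_conj.comp_aestronglyMeasurable hk.comp_neg.aestronglyMeasurable)
    (Eventually.of_forall fun a => ?_)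
  rw [RCLike.norm_conj]

/-- **Adjoint of a smeared operator**: `⟪∫ k(a) • U(a)φ da, ψ⟫ = ⟪φ, ∫ conj k(-a) • U(a)ψ da⟫`,
i.e. `U[k]* = U[k†]` with `k†(a) = conj k(-a)` (`U(a)* = U(-a)`). [folklore] -/
theorem inner_integral_smul_apply_left (U : UnitaryRep (Multiplicative P) H) {k : P → ℂ}
    (hk : Integrable k) (φ ψ : H) :
    ⟪∫ a, k a • U (Multiplicative.ofAdd a) φ, ψ⟫_ℂ =
      ⟪φ, ∫ a, conj (k (-a)) • U (Multiplicative.ofAdd a) ψ⟫_ℂ := by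
  rw [← inner_conj_symm, inner_integral_smul_apply U hk, ← integral_conj,
    inner_integral_smul_apply U (integrable_conj_comp_neg_vec hk)]
  rw [← integral_neg_eq_self
    (fun a => conj (k (-a)) * ⟪φ, U (Multiplicative.ofAdd a) ψ⟫_ℂ)]
  refine integral_congr_ae (Eventually.of_forall fun a => ?_)
  simp only [map_mul, inner_conj_symm, neg_neg, inner_apply_ofAdd_left]

omit [InnerProductSpace ℝ P] [FiniteDimensional ℝ P] [MeasurableSpace P] [BorelSpace P] in
/-- `U(t) (U(a) ψ) = U(a + t) ψ` (the group law). [folklore] -/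
theorem apply_ofAdd_apply_ofAdd (U : UnitaryRep (Multiplicative P) H) (t a : P) (ψ : H) :
    U (Multiplicative.ofAdd t) (U (Multiplicative.ofAdd a) ψ) =
      U (Multiplicative.ofAdd (a + t)) ψ := by
  rw [add_comm, ofAdd_add, map_mul, mul_apply_eq_comp]

/-- **Translation of a smeared vector**: `U(t) ∫ k(a) • U(a)ψ da = ∫ k(a - t) • U(a)ψ da`
(translation invariance of Lebesgue measure). [folklore] -/
theorem apply_integral_smul_apply (U : UnitaryRep (Multiplicative P) H) {k : P → ℂ}
    (hk : Integrable k) (ψ : H) (t : P) :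
    U (Multiplicative.ofAdd t) (∫ a, k a • U (Multiplicative.ofAdd a) ψ) =
      ∫ a, k (a - t) • U (Multiplicative.ofAdd a) ψ := by
  rw [← (U (Multiplicative.ofAdd t)).integral_comp_comm (U.integrable_smul_apply hk ψ)]
  rw [← integral_add_right_eq_self (fun a => k (a - t) • U (Multiplicative.ofAdd a) ψ) t]
  refine integral_congr_ae (Eventually.of_forall fun a => ?_)
  simp only [map_smul, add_sub_cancel_right, apply_ofAdd_apply_ofAdd]

/-- Smeared operators commute with the group: `U(t) ∫ k(a) • U(a)ψ da = ∫ k(a) • U(a) (U(t)ψ) da`.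
[folklore] -/
theorem apply_integral_smul_apply' (U : UnitaryRep (Multiplicative P) H) {k : P → ℂ}
    (hk : Integrable k) (ψ : H) (t : P) :
    U (Multiplicative.ofAdd t) (∫ a, k a • U (Multiplicative.ofAdd a) ψ) =
      ∫ a, k a • U (Multiplicative.ofAdd a) (U (Multiplicative.ofAdd t) ψ) := by
  rw [← (U (Multiplicative.ofAdd t)).integral_comp_comm (U.integrable_smul_apply hk ψ)]
  refine integral_congr_ae (Eventually.of_forall fun a => ?_)
  simp only [map_smul]
  rw [apply_ofAdd_apply_ofAdd, apply_ofAdd_apply_ofAdd, add_comm]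

/-! ### Products: `U[k₁] U[k₂] = U[k₁ ⋆ k₂]` -/

/-- **Product of smeared operators**:
`∫ k₁(a) • U(a) (∫ k₂(b) • U(b)ψ db) da = ∫ (∫ k₁(t) k₂(s - t) dt) • U(s)ψ ds`, i.e.
`U[k₁] U[k₂] = U[k₁ ⋆ k₂]` (group law, translation invariance and Fubini). [folklore] -/
theorem integral_smul_apply_integral_smul_apply (U : UnitaryRep (Multiplicative P) H)
    {k₁ k₂ : P → ℂ} (hk₁ : Integrable k₁) (hk₂ : Integrable k₂) (ψ : H) :
    ∫ a, k₁ a • U (Multiplicative.ofAdd a) (∫ b, k₂ b • U (Multiplicative.ofAdd b) ψ) =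
      ∫ s, (∫ t, k₁ t * k₂ (s - t)) • U (Multiplicative.ofAdd s) ψ := by
  -- the integrand `(t, s) ↦ k₁ t k₂ (s - t) • U(s) ψ` is integrable on `P × P`
  have hG : Integrable (fun p : P × P => k₁ p.2 * k₂ (p.1 - p.2)) (volume.prod volume) :=
    hk₁.convolution_integrand (ContinuousLinearMap.mul ℂ ℂ) hk₂
  have hF : Integrable (fun p : P × P => (k₁ p.1 * k₂ (p.2 - p.1)) • U (Multiplicative.ofAdd p.2) ψ)
      (volume.prod volume) := by
    have hG' := hG.swap
    refine (hG'.norm.mul_const ‖ψ‖).mono'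
      (hG'.aestronglyMeasurable.smul
        (((U.continuous_apply_apply ψ).comp continuous_ofAdd).comp
          continuous_snd).aestronglyMeasurable)
      (Eventually.of_forall fun p => ?_)
    simp only [Function.comp_apply, Prod.fst_swap, Prod.snd_swap]
    rw [norm_smul, norm_map]
  calc ∫ a, k₁ a • U (Multiplicative.ofAdd a) (∫ b, k₂ b • U (Multiplicative.ofAdd b) ψ)
      = ∫ a, ∫ b, (k₁ a * k₂ (b - a)) • U (Multiplicative.ofAdd b) ψ := by
        refine integral_congr_ae (Eventually.of_forall fun a => ?_)
        simp only
        rw [U.apply_integral_smul_apply hk₂ ψ a, ← integral_smul]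
        simp_rw [smul_smul]
    _ = ∫ b, ∫ a, (k₁ a * k₂ (b - a)) • U (Multiplicative.ofAdd b) ψ :=
        integral_integral_swap
          (f := fun a b => (k₁ a * k₂ (b - a)) • U (Multiplicative.ofAdd b) ψ) hF
    _ = ∫ s, (∫ t, k₁ t * k₂ (s - t)) • U (Multiplicative.ofAdd s) ψ := by
        refine integral_congr_ae (Eventually.of_forall fun b => ?_)
        simp only
        rw [integral_smul_const]

/-! ### Approximate identities -/

/-- **Approximate identity**: for integrable `k`, `∫ Rᴰ k(R a) • U(a)x da → (∫ k) • x` as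
`R → ∞`, `D = dim P` (substitute `a = b / R` and use strong continuity under the integral sign,
dominated by `‖k(b)‖ ‖x‖`). [folklore] -/
theorem tendsto_integral_dilate_smul_apply (U : UnitaryRep (Multiplicative P) H) {k : P → ℂ}
    (hk : Integrable k) (x : H) :
    Tendsto (fun R : ℝ => ∫ a, ((R : ℂ) ^ Module.finrank ℝ P * k (R • a)) •
      U (Multiplicative.ofAdd a) x) atTop (𝓝 ((∫ a, k a) • x)) := by
  -- substitution `b = R a` for `R > 0`
  have key : ∀ R : ℝ, 0 < R →
      ∫ a, ((R : ℂ) ^ Module.finrank ℝ P * k (R • a)) • U (Multiplicative.ofAdd a) x =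
        ∫ b, k b • U (Multiplicative.ofAdd (R⁻¹ • b)) x := by
    intro R hR
    have h := Measure.integral_comp_smul volume
      (fun b => ((R : ℂ) ^ Module.finrank ℝ P * k b) • U (Multiplicative.ofAdd (R⁻¹ • b)) x) R
    simp only [inv_smul_smul₀ hR.ne'] at h
    rw [h, abs_of_pos (inv_pos.mpr (pow_pos hR _)), ← integral_smul]
    refine integral_congr_ae (Eventually.of_forall fun b => ?_)
    simp only
    rw [← Complex.coe_smul, smul_smul, ← mul_assoc, Complex.ofReal_inv, Complex.ofReal_pow,
      inv_mul_cancel₀ (pow_ne_zero _ (Complex.ofReal_ne_zero.mpr hR.ne')), one_mul]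
  -- dominated convergence as `R → ∞`
  have hlim : Tendsto (fun R : ℝ => ∫ b, k b • U (Multiplicative.ofAdd (R⁻¹ • b)) x) atTop
      (𝓝 (∫ b, k b • x)) := by
    refine tendsto_integral_filter_of_dominated_convergence (fun b => ‖k b‖ * ‖x‖) ?_ ?_
      (hk.norm.mul_const ‖x‖) ?_
    · refine Eventually.of_forall fun R => ?_
      exact hk.aestronglyMeasurable.smul
        (((U.continuous_apply_apply x).comp continuous_ofAdd).comp
          (continuous_const.smul continuous_id)).aestronglyMeasurable
    · refine Eventually.of_forall fun R => Eventually.of_forall fun b => ?_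
      rw [norm_smul, norm_map]
    · refine Eventually.of_forall fun b => ?_
      have hc : Continuous fun s : P => k b • U (Multiplicative.ofAdd s) x := by fun_prop
      have h0 : Tendsto (fun R : ℝ => R⁻¹ • b) atTop (𝓝 0) := by
        simpa using (tendsto_inv_atTop_zero (𝕜 := ℝ)).smul_const b
      have h1 : Tendsto (fun s : P => k b • U (Multiplicative.ofAdd s) x) (𝓝 0) (𝓝 (k b • x)) := by
        have := hc.tendsto 0
        rwa [ofAdd_zero, map_one, one_apply_eq_self] at this
      exact h1.comp h0
  rw [integral_smul_const] at hlim
  refine hlim.congr' ?_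
  filter_upwards [eventually_gt_atTop 0] with R hR
  exact (key R hR).symm

/-! ### Translations along a direction: the generator and integration by parts -/

omit [FiniteDimensional ℝ P] [MeasurableSpace P] [BorelSpace P] in
/-- `(U.alongDirection e).appReal t = U (ofAdd (t • e))` (by definition). [folklore] -/
theorem alongDirection_appReal (U : UnitaryRep (Multiplicative P) H) (e : P) (t : ℝ) :
    (U.alongDirection e).appReal t = U (Multiplicative.ofAdd (t • e)) := rfl

omit [FiniteDimensional ℝ P] [MeasurableSpace P] [BorelSpace P] in
/-- The orbit `a ↦ U(a) x` of `x ∈ D(A_e)` has line derivative `U(a) A_e x` along `e`, where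
`A_e` generates `t ↦ U(t e)` (Reed–Simon I, Thm. VIII.7 (c): `d/dt U(t)x = U(t)Ax`).
[cite: ReedSimonI1980, Thm VIII.7 (c)] -/
theorem hasLineDerivAt_apply_ofAdd (U : UnitaryRep (Multiplicative P) H) (e : P)
    (x : (OneParameterGroup.generator (U.alongDirection e).toStrongContRepresentation).domain)
    (a : P) :
    HasLineDerivAt ℝ (fun b : P => U (Multiplicative.ofAdd b) (x : H))
      (U (Multiplicative.ofAdd a)
        (OneParameterGroup.generator (U.alongDirection e).toStrongContRepresentation x)) a e := by
  have h0 := (U.alongDirection e).hasDerivAt_appReal_apply x 0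
  rw [appReal_zero, one_apply_eq_self] at h0
  have h1 := ((U (Multiplicative.ofAdd a)).restrictScalars ℝ).hasFDerivAt.comp_hasDerivAt 0 h0
  refine h1.congr_of_eventuallyEq (Eventually.of_forall fun t => ?_)
  simp only [Function.comp_apply, ContinuousLinearMap.coe_restrictScalars', alongDirection_appReal,
    apply_ofAdd_apply_ofAdd, add_comm a]

/-- **Smeared operators preserve `D(A_e)` and commute with `A_e`**: for `x ∈ D(A_e)` and
integrable `k`, `∫ k(a) • U(a)x da ∈ D(A_e)` and `A_e ∫ k(a) • U(a)x da = ∫ k(a) • U(a)(A_e x) da`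
(the smeared operator is bounded and commutes with every `U(t e)`; Reed–Simon I, Thm. VIII.7).
[cite: ReedSimonI1980, Thm VIII.7] -/
theorem integral_smul_apply_mem_generator_domain (U : UnitaryRep (Multiplicative P) H) (e : P)
    {k : P → ℂ} (hk : Integrable k)
    (x : (OneParameterGroup.generator (U.alongDirection e).toStrongContRepresentation).domain) :
    ∃ h : (∫ a, k a • U (Multiplicative.ofAdd a) (x : H)) ∈
        (OneParameterGroup.generator (U.alongDirection e).toStrongContRepresentation).domain,
      OneParameterGroup.generator (U.alongDirection e).toStrongContRepresentation ⟨_, h⟩ =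
        ∫ a, k a • U (Multiplicative.ofAdd a)
          (OneParameterGroup.generator (U.alongDirection e).toStrongContRepresentation x) := by
  obtain ⟨S, hS⟩ := U.exists_clm_integral_smul_apply hk
  apply OneParameterGroup.mem_generator_domain_of_hasDerivAt
  have h0 := (U.alongDirection e).hasDerivAt_appReal_apply x 0
  rw [appReal_zero, one_apply_eq_self] at h0
  have h1 := (S.restrictScalars ℝ).hasFDerivAt.comp_hasDerivAt 0 h0
  refine (h1.congr_of_eventuallyEq (Eventually.of_forall fun t => ?_)).congr_deriv ?_
  · simp only [Function.comp_apply, ContinuousLinearMap.coe_restrictScalars',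
      app_toStrongContRepresentation, hS, alongDirection_appReal]
    exact U.apply_integral_smul_apply' hk x (t • e)
  · simp only [ContinuousLinearMap.coe_restrictScalars', hS]

/-- **Integration by parts against an orbit**: for a Schwartz kernel `k`, a direction `e` and
`x ∈ D(A_e)`, `∫ k(a) • U(a)(A_e x) da = -∫ (∂_e k)(a) • U(a)x da` (`∂_e U(a)x = U(a)A_e x` and
integration by parts along `e`, Mathlib's
`integral_bilinear_hasLineDerivAt_right_eq_neg_left_of_integrable`). [folklore] -/
theorem integral_smul_apply_generator_eq_neg (U : UnitaryRep (Multiplicative P) H) (e : P)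
    (k : 𝓢(P, ℂ))
    (x : (OneParameterGroup.generator (U.alongDirection e).toStrongContRepresentation).domain) :
    ∫ a, k a • U (Multiplicative.ofAdd a)
        (OneParameterGroup.generator (U.alongDirection e).toStrongContRepresentation x) =
      -∫ a, (∂_{e} k : 𝓢(P, ℂ)) a • U (Multiplicative.ofAdd a) (x : H) := by
  have hdk : Integrable ((∂_{e} k : 𝓢(P, ℂ)) : P → ℂ) := (∂_{e} k : 𝓢(P, ℂ)).integrable
  have := integral_bilinear_hasLineDerivAt_right_eq_neg_left_of_integrable (μ := volume)
    (B := ContinuousLinearMap.lsmul ℝ ℂ (E := H))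
    (f := (k : P → ℂ)) (f' := ((∂_{e} k : 𝓢(P, ℂ)) : P → ℂ))
    (g := fun a => U (Multiplicative.ofAdd a) (x : H))
    (g' := fun a => U (Multiplicative.ofAdd a)
      (OneParameterGroup.generator (U.alongDirection e).toStrongContRepresentation x))
    (v := e)
    (by simpa using U.integrable_smul_apply hdk (x : H))
    (by
      simpa using U.integrable_smul_apply k.integrable
        (OneParameterGroup.generator (U.alongDirection e).toStrongContRepresentation x))
    (by simpa using U.integrable_smul_apply k.integrable (x : H))
    (fun a _ => by
      rw [SchwartzMap.lineDerivOp_apply_eq_fderiv]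
      exact (k.hasFDerivAt a).hasLineDerivAt e)
    (fun a _ => U.hasLineDerivAt_apply_ofAdd e x a)
  simpa using this

end UnitaryRep

end Literature.Analysis.UnboundedOperators
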